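import Summits.ResolutionOfSingularities.ResolutionOfSingularities.Theorems.FrobeniusClosingSteerEtaleWindowLevel
import Summits.ResolutionOfSingularities.ResolutionOfSingularities.Theorems.FrobeniusClosingSteerEtaleWindowStep
import Summits.ResolutionOfSingularities.ResolutionOfSingularities.Theorems.FrobeniusClosingSteerEtaleWindowRational
import Summits.ResolutionOfSingularities.ResolutionOfSingularities.Theorems.FrobeniusClosingSteerEtaleWindowWords
import HarnessLib

/-!
# [OURS · L0 W4.1] K3-a part 4, stage B2c: the RATIONAL WINDOW LIFT `exists_rational_window_lift` (assembly)
# (chain W4.1 `FrobeniusClosingSteer`, crux stmt-ResolutionOfSingularities-16345; K3 route (R1), res-L0-w41-plan-1 RULINGs 250(a)/258/280(a);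
# interface of record `D/res-D-lib-1/K3WindowInterface.lean` 1dc250035b4b213c; `--supports … --as helper`)

HONEST FRAMING. OURS kernel (HIRONAKA-L librarian res-D-lib-1 gen 7 draft, gen 8 assembly). Assembles `…EtaleResidueLift{,Maps}`,
`…QuadraticTransformResiduallyFinite` (stage A `exists_monic_lift_primitive`), `…EtaleWindowLevel` (B1), `…EtaleWindowStep` (B2a) and
`…EtaleWindowRational` (B2b) into the ∃-theorem of the interface, consumed by K3-b (res-D-pv-040, `…QuadraticTransformLevelLift`) and K3-d (lib-1):
* `levelLift_range` — the word `EtaleLift.LevelLift S (range j) (j ∘ (S → T)) (j x)` for `T := (S[X]/(P))_𝔫` and an injective `j : T → L′`;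
* `separable_map_inclusion`, `injective_liftHom'` (ker-form of `injective_liftHom`), `map_algebraMap_of_comp_eq` / `map_root_of_comp_eq` (squares and
  roots along any map over the change of rings `S[X]/(P) → S′[X]/(P)`), `lift_liftMap_mk` (value of `(S′[X]/(P) → k′) ∘ ι` on a class);
* **`exists_rational_window_lift`**: for a window `S₀ ⊂ S₁ ⊂ S₂ ⊂ S₃ ⊆ L` of quadratic transforms of regular local rings of one dimension with `κ(S₀)`
  perfect: `θ̄` primitive for `κ(S₂)/κ(S₀)` (finite separable), `P ∈ S₀[X]` a monic lift of its minimal polynomial, `Aᵢ := Sᵢ[X]/(P)`, `𝔫ᵢ := ker (Aᵢ → κ(S₃),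
  X ↦ θ̄)`, `Tᵢ := (Aᵢ)_𝔫ᵢ` (regular local, faithfully flat and unramified over `Sᵢ`), `gᵢ : Tᵢ → Tᵢ₊₁` the INJECTIVE local maps over the changes of rings,
  `L′ := Frac T₃`, `S′ᵢ := range (Tᵢ → T₃ → L′)`; the four `LevelLift` packages, the commuting squares, dominance `S′ᵢ ≺ S′ᵢ₊₁`, and RESIDUAL RATIONALITY
  of `S′₀ ≤ S′₁ ≤ S′₂` (every coefficient `c ∈ Sᵢ₊₁` has residue `q(θ̄)` with `q ∈ S₀[X]`, so `c ≡ ιᵢ[q] (mod 𝔫ᵢ₊₁)`).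
Statement = the interface of record verbatim up to the lint-forced binder spellings `_hdim₃` (idle: `LevelLift` transfers the dimension of `S₃` whatever
it is) and `_h₂₃'`.
Nothing here is a statement of H. Hironaka's manuscript [Hironaka2017]. AI-written; AI review is weaker than expert review. [cite: StacksProject, Tag 00TV]
-/

set_option linter.dupNamespace false

noncomputable section

namespace Summit.ResolutionOfSingularities.ResolutionOfSingularities.Theorems.SwitchingDichotomy.EtaleLift

open IsLocalRing Polynomial Literature.AlgebraicGeometry.Resolution
open Summit.ResolutionOfSingularities.ResolutionOfSingularities.Theorems.SwitchingDichotomy.SigmaTopLegality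

/-! ## §1 Packaging one level -/

section Pack

variable {L : Type} [Field L] {S : Subring L} [IsLocalRing S] (P : S[X]) {k' : Type} [Field k']
  (φ : ResidueField S →+* k') (θ : k') (hθ : P.eval₂ (φ.comp (residue S)) θ = 0) {L' : Type} [Field L']

/-- **`LevelLift` for the range of an injective `(S[X]/(P))_𝔫 → L′`** (all conjuncts from `…EtaleWindowLevel`). [cite: StacksProject, Tag 00TV] -/
theorem levelLift_range [IsNoetherianRing S] (hP : P.Monic) (hsep : (P.map (residue S)).Separable)
    (j : (haveI := isMaximal_ker_lift P φ θ hθ hP;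
      Localization.AtPrime (RingHom.ker (AdjoinRoot.lift (φ.comp (residue S)) θ hθ))) →+* L') (hj : Function.Injective j) :
    haveI := isMaximal_ker_lift P φ θ hθ hP
    haveI := isLocalRing_range j
    LevelLift S j.range (j.rangeRestrict.comp (algebraMap S _)) (j (algebraMap (AdjoinRoot P) _ (AdjoinRoot.root P))) := by
  haveI := isMaximal_ker_lift P φ θ hθ hP
  haveI := isLocalRing_range j
  refine ⟨isLocalHom_rangeLift P φ θ hθ hP j hj, map_maximalIdeal_rangeLift P φ θ hθ hP hsep j hj,
    comap_map_rangeLift P φ θ hθ hP j hj, root_mem_range P φ θ hθ hP j,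
    fun z hz => exists_div_of_mem_range P φ θ hθ hP j hj z hz,
    fun hreg => isRegularLocalRing_range P φ θ hθ hreg hP hsep j hj, ringKrullDim_range P φ θ hθ hP hsep j hj,
    fun hexc => isExcellentRing_range P φ θ hθ hP hexc j hj,
    fun hperf => ?_, fun f hf => hasIsolatedSingularity_radicand_range P φ θ hθ 2 hP hsep j hj f hf⟩
  haveI := hperf
  exact perfectField_residueField_range P φ θ hθ hP j hj

end Pack


/-! ## §2 Helpers for the tower -/

section Tower

variable {L : Type} [Field L]

/-- Separability of the reduction is preserved along a local inclusion of local subrings. [folklore] -/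
theorem separable_map_inclusion {S S' : Subring L} [IsLocalRing S] [IsLocalRing S'] (hd : SubringDominates S S') (P : S[X])
    (hsep : (P.map (residue S)).Separable) : ((P.map (Subring.inclusion hd.1)).map (residue S')).Separable := by
  haveI := isLocalHom_inclusion_of_subringDominates hd
  have hfun : (residue S').comp (Subring.inclusion hd.1) = (ResidueField.map (Subring.inclusion hd.1)).comp (residue S) := by
    ext s
    change residue S' (Subring.inclusion hd.1 s) = ResidueField.map (Subring.inclusion hd.1) (residue S s)
    rw [ResidueField.map_residue]
  have : (P.map (Subring.inclusion hd.1)).map (residue S') = (P.map (residue S)).map (ResidueField.map (Subring.inclusion hd.1)) := by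
    rw [Polynomial.map_map, Polynomial.map_map, hfun]
  rw [this]
  exact hsep.map

/-- Injectivity of any map over the change of rings out of `(S[X]/(P))_I` for an ideal `I` EQUAL to the pulled-back prime (the `ker`-form of
`injective_liftHom`). [cite: StacksProject, Tag 00TV] -/
theorem injective_liftHom' {S S' : Subring L} [IsLocalRing S] [IsLocalRing S'] (hd : SubringDominates S S') (P : S[X]) {k' : Type} [Field k']
    (φ' : ResidueField S' →+* k') (θ : k') (hθ' : (P.map (Subring.inclusion hd.1)).eval₂ (φ'.comp (residue S')) θ = 0)
    (hreg : IsRegularLocalRing S) (hreg' : IsRegularLocalRing S') (hP : P.Monic) (hsep : (P.map (residue S)).Separable)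
    (I : Ideal (AdjoinRoot P)) [I.IsPrime]
    (hI : I = (haveI := isMaximal_ker_lift (P.map (Subring.inclusion hd.1)) φ' θ hθ' (hP.map _)
      (RingHom.ker (AdjoinRoot.lift (φ'.comp (residue S')) θ hθ')).comap
        (AdjoinRoot.lift ((AdjoinRoot.of (P.map (Subring.inclusion hd.1))).comp (Subring.inclusion hd.1))
          (AdjoinRoot.root (P.map (Subring.inclusion hd.1))) (eval₂_root_map_eq_zero (Subring.inclusion hd.1) P))))
    (g : Localization.AtPrime I →+*
      (haveI := isMaximal_ker_lift (P.map (Subring.inclusion hd.1)) φ' θ hθ' (hP.map _)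
      Localization.AtPrime (RingHom.ker (AdjoinRoot.lift (φ'.comp (residue S')) θ hθ'))))
    (hg : (haveI := isMaximal_ker_lift (P.map (Subring.inclusion hd.1)) φ' θ hθ' (hP.map _)
      g.comp (algebraMap (AdjoinRoot P) _) = (algebraMap (AdjoinRoot (P.map (Subring.inclusion hd.1))) _).comp
        (AdjoinRoot.lift ((AdjoinRoot.of (P.map (Subring.inclusion hd.1))).comp (Subring.inclusion hd.1))
          (AdjoinRoot.root (P.map (Subring.inclusion hd.1))) (eval₂_root_map_eq_zero (Subring.inclusion hd.1) P)))) :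
    Function.Injective g := by
  subst hI
  exact injective_liftHom hd P φ' θ hθ' hreg hreg' hP hsep g hg

end Tower

/-! ## §2b Generic computations over the change of rings `S[X]/(P) → S′[X]/(P)` -/

section Generic

variable {S S' : Type} [CommRing S] [CommRing S'] (f : S →+* S') (P : S[X])
  {B B' : Type} [CommRing B] [CommRing B'] [Algebra (AdjoinRoot P) B] [Algebra S B] [IsScalarTower S (AdjoinRoot P) B]
  [Algebra (AdjoinRoot (P.map f)) B'] [Algebra S' B'] [IsScalarTower S' (AdjoinRoot (P.map f)) B']
  (g : B →+* B')
  (hg : g.comp (algebraMap (AdjoinRoot P) B) = (algebraMap (AdjoinRoot (P.map f)) B').comp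
    (AdjoinRoot.lift ((AdjoinRoot.of (P.map f)).comp f) (AdjoinRoot.root (P.map f)) (eval₂_root_map_eq_zero f P)))

include hg

/-- **The squares commute**: `g (s read in B) = (f s read in B′)` for any `g : B → B′` over the change of rings. [folklore] -/
theorem map_algebraMap_of_comp_eq (s : S) : g (algebraMap S B s) = algebraMap S' B' (f s) := by
  have h1 := congrArg (fun F => F (AdjoinRoot.of P s)) hg
  simp only [RingHom.comp_apply, AdjoinRoot.lift_of] at h1
  rw [IsScalarTower.algebraMap_apply S (AdjoinRoot P) B, AdjoinRoot.algebraMap_eq, h1,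
    IsScalarTower.algebraMap_apply S' (AdjoinRoot (P.map f)) B', AdjoinRoot.algebraMap_eq]

omit [Algebra S B] [IsScalarTower S (AdjoinRoot P) B] [Algebra S' B'] [IsScalarTower S' (AdjoinRoot (P.map f)) B'] in
/-- **The roots correspond**: `g (x read in B) = (x′ read in B′)` for any `g : B → B′` over the change of rings. [folklore] -/
theorem map_root_of_comp_eq :
    g (algebraMap (AdjoinRoot P) B (AdjoinRoot.root P)) = algebraMap (AdjoinRoot (P.map f)) B' (AdjoinRoot.root (P.map f)) := by
  have h1 := congrArg (fun F => F (AdjoinRoot.root P)) hg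
  simp only [RingHom.comp_apply, AdjoinRoot.lift_root] at h1
  exact h1

end Generic

section Coeff

variable {L : Type} [Field L] {S S' : Subring L} [IsLocalRing S] [IsLocalRing S'] (hd : SubringDominates S S')
  (P : S[X]) {k' : Type} [Field k'] (φ' : ResidueField S' →+* k') (θ : k')
  (hθ' : (P.map (Subring.inclusion hd.1)).eval₂ (φ'.comp (residue S')) θ = 0)

/-- The value of `(S′[X]/(P) → k′) ∘ ι` on a class `[q]`, `q ∈ S[X]`: it is `q(θ)` read through `κ(S) → κ(S′) → k′`. [folklore] -/
theorem lift_liftMap_mk (q : S[X]) :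
    haveI := isLocalHom_inclusion_of_subringDominates hd
    AdjoinRoot.lift (φ'.comp (residue S')) θ hθ'
      (AdjoinRoot.lift ((AdjoinRoot.of (P.map (Subring.inclusion hd.1))).comp (Subring.inclusion hd.1))
        (AdjoinRoot.root (P.map (Subring.inclusion hd.1))) (eval₂_root_map_eq_zero (Subring.inclusion hd.1) P) (AdjoinRoot.mk P q)) =
      q.eval₂ ((φ'.comp (ResidueField.map (Subring.inclusion hd.1))).comp (residue S)) θ := by
  haveI := isLocalHom_inclusion_of_subringDominates hd
  have hfun : (φ'.comp (ResidueField.map (Subring.inclusion hd.1))).comp (residue S) =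
      (φ'.comp (residue S')).comp (Subring.inclusion hd.1) := by
    ext s
    change φ' (ResidueField.map (Subring.inclusion hd.1) (residue S s)) = φ' (residue S' (Subring.inclusion hd.1 s))
    rw [ResidueField.map_residue]
  rw [lift_mk_eq_mk_map, AdjoinRoot.lift_mk, Polynomial.eval₂_map, hfun]

end Coeff


/-! ## §3 The rational window lift -/

set_option maxHeartbeats 400000 in
/-- **K3-a part 4: the RATIONAL WINDOW LIFT.** For a window `S₀ ⊂ S₁ ⊂ S₂ ⊂ S₃ ⊆ L` of quadratic transforms of regular local rings without
dimension drop and with `κ(S₀)` perfect, there are a field `L′`, local subrings `S′₀ ≤ S′₁ ≤ S′₂ ≤ S′₃ ⊆ L′`, an element `θ ∈ S′₀`, a monic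
`P ∈ S₀[X]` and local ring maps `φᵢ : Sᵢ → S′ᵢ` with: `P(θ) = 0` through `φ₀`; `LevelLift Sᵢ S′ᵢ φᵢ θ` at each level; the squares commute in `L′`;
upstairs domination; and RESIDUAL RATIONALITY of the two lower steps. (Construction: `θ̄` primitive for `κ(S₂)/κ(S₀)`, `P` a monic lift of its minimal
polynomial, `S′ᵢ ≅ (Sᵢ[X]/(P))_𝔫ᵢ` read in `L′ := Frac (S₃[X]/(P))_𝔫₃`.) [cite: StacksProject, Tag 00TV] -/
theorem exists_rational_window_lift {L : Type} [Field L] {S₀ S₁ S₂ S₃ : Subring L}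
    [IsLocalRing S₀] [IsLocalRing S₁] [IsLocalRing S₂] [IsLocalRing S₃]
    (h₀₁ : IsQuadraticTransform S₀ S₁) (h₁₂ : IsQuadraticTransform S₁ S₂) (h₂₃ : IsQuadraticTransform S₂ S₃)
    (hreg₀ : IsRegularLocalRing S₀) (hreg₁ : IsRegularLocalRing S₁) (hreg₂ : IsRegularLocalRing S₂) (hreg₃ : IsRegularLocalRing S₃)
    {c : ℕ} (hdim₀ : ringKrullDim S₀ = c) (hdim₁ : ringKrullDim S₁ = c) (hdim₂ : ringKrullDim S₂ = c) (_hdim₃ : ringKrullDim S₃ = c)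
    [PerfectField (ResidueField S₀)] :
    ∃ (L' : Type) (_ : Field L') (S₀' S₁' S₂' S₃' : Subring L')
      (_ : IsLocalRing S₀') (_ : IsLocalRing S₁') (_ : IsLocalRing S₂') (_ : IsLocalRing S₃')
      (θ : L') (P : S₀[X]) (φ₀ : S₀ →+* S₀') (φ₁ : S₁ →+* S₁') (φ₂ : S₂ →+* S₂') (φ₃ : S₃ →+* S₃')
      (h₀₁' : S₀' ≤ S₁') (h₁₂' : S₁' ≤ S₂') (_h₂₃' : S₂' ≤ S₃'),
      P.Monic ∧ P.eval₂ ((S₀'.subtype).comp φ₀) θ = 0 ∧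
      LevelLift S₀ S₀' φ₀ θ ∧ LevelLift S₁ S₁' φ₁ θ ∧ LevelLift S₂ S₂' φ₂ θ ∧ LevelLift S₃ S₃' φ₃ θ ∧
      (∀ s : S₀, ((φ₁ (Subring.inclusion h₀₁.dominates.1 s) : S₁') : L') = ((φ₀ s : S₀') : L')) ∧
      (∀ s : S₁, ((φ₂ (Subring.inclusion h₁₂.dominates.1 s) : S₂') : L') = ((φ₁ s : S₁') : L')) ∧
      (∀ s : S₂, ((φ₃ (Subring.inclusion h₂₃.dominates.1 s) : S₃') : L') = ((φ₂ s : S₂') : L')) ∧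
      SubringDominates S₀' S₁' ∧ SubringDominates S₁' S₂' ∧ SubringDominates S₂' S₃' ∧
      IsResiduallyRational S₀' S₁' h₀₁' ∧ IsResiduallyRational S₁' S₂' h₁₂' := by
  classical
  haveI := hreg₀; haveI := hreg₁; haveI := hreg₂; haveI := hreg₃
  have d₀₁ := h₀₁.dominates
  have d₁₂ := h₁₂.dominates
  have d₂₃ := h₂₃.dominates
  haveI := isLocalHom_inclusion_of_subringDominates d₀₁
  haveI := isLocalHom_inclusion_of_subringDominates d₁₂
  haveI := isLocalHom_inclusion_of_subringDominates d₂₃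
  haveI := isLocalHom_inclusion_of_subringDominates (d₀₁.trans d₁₂)
  -- ### stage A: primitive element of `κ(S₂)/κ(S₀)` and a monic lift of its minimal polynomial
  obtain ⟨P, θb, hPmon, -, hsep₀, hθb, hprim⟩ := exists_monic_lift_primitive h₀₁ h₁₂ hreg₀ hreg₁ hdim₀ hdim₁ hdim₂
  -- ### the tower of polynomials and residue maps, built DOWN from the top
  set P₁ := P.map (Subring.inclusion d₀₁.1) with hP₁
  set P₂ := P₁.map (Subring.inclusion d₁₂.1) with hP₂
  set P₃ := P₂.map (Subring.inclusion d₂₃.1) with hP₃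
  set φ₃ : ResidueField S₃ →+* ResidueField S₃ := RingHom.id _ with hφ₃
  set φ₂ : ResidueField S₂ →+* ResidueField S₃ := φ₃.comp (ResidueField.map (Subring.inclusion d₂₃.1)) with hφ₂
  set φ₁ : ResidueField S₁ →+* ResidueField S₃ := φ₂.comp (ResidueField.map (Subring.inclusion d₁₂.1)) with hφ₁
  set φ₀ : ResidueField S₀ →+* ResidueField S₃ := φ₁.comp (ResidueField.map (Subring.inclusion d₀₁.1)) with hφ₀
  set θ : ResidueField S₃ := ResidueField.map (Subring.inclusion d₂₃.1) θb with hθ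
  -- the relation at the top, then at each level below
  have hθ₃ : P₃.eval₂ (φ₃.comp (residue S₃)) θ = 0 := by
    have hfun : (φ₃.comp (residue S₃)).comp (((Subring.inclusion d₂₃.1).comp (Subring.inclusion d₁₂.1)).comp (Subring.inclusion d₀₁.1)) =
        (ResidueField.map (Subring.inclusion d₂₃.1)).comp
          ((ResidueField.map (Subring.inclusion (d₀₁.trans d₁₂).1)).comp (residue S₀)) := by
      ext s
      simp only [RingHom.comp_apply, hφ₃, RingHom.id_apply, ResidueField.map_residue]
      rfl
    rw [hP₃, hP₂, hP₁, Polynomial.map_map, Polynomial.map_map, Polynomial.eval₂_map, hfun, hθ, ← Polynomial.hom_eval₂, hθb,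
      map_zero]
  have hθ₂ : P₂.eval₂ (φ₂.comp (residue S₂)) θ = 0 := eval₂_inclusion_of_eval₂ d₂₃ P₂ φ₃ θ hθ₃
  have hθ₁ : P₁.eval₂ (φ₁.comp (residue S₁)) θ = 0 := eval₂_inclusion_of_eval₂ d₁₂ P₁ φ₂ θ hθ₂
  have hθ₀ : P.eval₂ (φ₀.comp (residue S₀)) θ = 0 := eval₂_inclusion_of_eval₂ d₀₁ P φ₁ θ hθ₁
  -- monicity and separability along the tower
  have hP₁m : P₁.Monic := hPmon.map _
  have hP₂m : P₂.Monic := hP₁m.map _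
  have hP₃m : P₃.Monic := hP₂m.map _
  have hsep₁ : (P₁.map (residue S₁)).Separable := separable_map_inclusion d₀₁ P hsep₀
  have hsep₂ : (P₂.map (residue S₂)).Separable := separable_map_inclusion d₁₂ P₁ hsep₁
  have hsep₃ : (P₃.map (residue S₃)).Separable := separable_map_inclusion d₂₃ P₂ hsep₂
  -- ### the four kernels `𝔫ᵢ` are maximal
  haveI hm₃ := isMaximal_ker_lift P₃ φ₃ θ hθ₃ hP₃m
  haveI hm₂ := isMaximal_ker_lift P₂ φ₂ θ hθ₂ hP₂m
  haveI hm₁ := isMaximal_ker_lift P₁ φ₁ θ hθ₁ hP₁m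
  haveI hm₀ := isMaximal_ker_lift P φ₀ θ hθ₀ hPmon
  -- ### the changes of rings `ιᵢ : Sᵢ[X]/(P) → Sᵢ₊₁[X]/(P)` and the kernel compatibilities `𝔫ᵢ = ιᵢ⁻¹ 𝔫ᵢ₊₁`
  let ι₂ := AdjoinRoot.lift ((AdjoinRoot.of (P₂.map (Subring.inclusion d₂₃.1))).comp (Subring.inclusion d₂₃.1))
    (AdjoinRoot.root (P₂.map (Subring.inclusion d₂₃.1))) (eval₂_root_map_eq_zero (Subring.inclusion d₂₃.1) P₂)
  let ι₁ := AdjoinRoot.lift ((AdjoinRoot.of (P₁.map (Subring.inclusion d₁₂.1))).comp (Subring.inclusion d₁₂.1))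
    (AdjoinRoot.root (P₁.map (Subring.inclusion d₁₂.1))) (eval₂_root_map_eq_zero (Subring.inclusion d₁₂.1) P₁)
  let ι₀ := AdjoinRoot.lift ((AdjoinRoot.of (P.map (Subring.inclusion d₀₁.1))).comp (Subring.inclusion d₀₁.1))
    (AdjoinRoot.root (P.map (Subring.inclusion d₀₁.1))) (eval₂_root_map_eq_zero (Subring.inclusion d₀₁.1) P)
  have hk₂ : RingHom.ker (AdjoinRoot.lift (φ₂.comp (residue S₂)) θ hθ₂) =
      (RingHom.ker (AdjoinRoot.lift (φ₃.comp (residue S₃)) θ hθ₃)).comap ι₂ := ker_lift_eq_comap d₂₃ P₂ φ₃ θ hθ₃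
  have hk₁ : RingHom.ker (AdjoinRoot.lift (φ₁.comp (residue S₁)) θ hθ₁) =
      (RingHom.ker (AdjoinRoot.lift (φ₂.comp (residue S₂)) θ hθ₂)).comap ι₁ := ker_lift_eq_comap d₁₂ P₁ φ₂ θ hθ₂
  have hk₀ : RingHom.ker (AdjoinRoot.lift (φ₀.comp (residue S₀)) θ hθ₀) =
      (RingHom.ker (AdjoinRoot.lift (φ₁.comp (residue S₁)) θ hθ₁)).comap ι₀ := ker_lift_eq_comap d₀₁ P φ₁ θ hθ₁
  -- ### the local maps `gᵢ : Tᵢ → Tᵢ₊₁`, `Tᵢ := (Sᵢ[X]/(P))_𝔫ᵢ`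
  let g₂ := Localization.localRingHom (RingHom.ker (AdjoinRoot.lift (φ₂.comp (residue S₂)) θ hθ₂))
    (RingHom.ker (AdjoinRoot.lift (φ₃.comp (residue S₃)) θ hθ₃)) ι₂ hk₂
  let g₁ := Localization.localRingHom (RingHom.ker (AdjoinRoot.lift (φ₁.comp (residue S₁)) θ hθ₁))
    (RingHom.ker (AdjoinRoot.lift (φ₂.comp (residue S₂)) θ hθ₂)) ι₁ hk₁
  let g₀ := Localization.localRingHom (RingHom.ker (AdjoinRoot.lift (φ₀.comp (residue S₀)) θ hθ₀))
    (RingHom.ker (AdjoinRoot.lift (φ₁.comp (residue S₁)) θ hθ₁)) ι₀ hk₀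
  have hg₂ : g₂.comp (algebraMap (AdjoinRoot P₂) _) = (algebraMap (AdjoinRoot P₃) _).comp ι₂ := by
    refine RingHom.ext fun a => ?_
    exact Localization.localRingHom_to_map _ _ _ hk₂ a
  have hg₁ : g₁.comp (algebraMap (AdjoinRoot P₁) _) = (algebraMap (AdjoinRoot P₂) _).comp ι₁ := by
    refine RingHom.ext fun a => ?_
    exact Localization.localRingHom_to_map _ _ _ hk₁ a
  have hg₀ : g₀.comp (algebraMap (AdjoinRoot P) _) = (algebraMap (AdjoinRoot P₁) _).comp ι₀ := by
    refine RingHom.ext fun a => ?_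
    exact Localization.localRingHom_to_map _ _ _ hk₀ a
  have hginj₂ : Function.Injective g₂ := injective_liftHom' d₂₃ P₂ φ₃ θ hθ₃ hreg₂ hreg₃ hP₂m hsep₂ _ hk₂ g₂ hg₂
  have hginj₁ : Function.Injective g₁ := injective_liftHom' d₁₂ P₁ φ₂ θ hθ₂ hreg₁ hreg₂ hP₁m hsep₁ _ hk₁ g₁ hg₁
  have hginj₀ : Function.Injective g₀ := injective_liftHom' d₀₁ P φ₁ θ hθ₁ hreg₀ hreg₁ hPmon hsep₀ _ hk₀ g₀ hg₀
  -- ### the field `L′ := Frac T₃` and the four injective embeddings `jᵢ : Tᵢ → L′`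
  have hregT₃ := isRegularLocalRing_localization_ker_lift P₃ φ₃ θ hθ₃ hreg₃ hP₃m hsep₃
  haveI hdomT₃ := @isDomain_of_isRegularLocalRing _ _ hregT₃
  let j₃ : Localization.AtPrime (RingHom.ker (AdjoinRoot.lift (φ₃.comp (residue S₃)) θ hθ₃)) →+*
      FractionRing (Localization.AtPrime (RingHom.ker (AdjoinRoot.lift (φ₃.comp (residue S₃)) θ hθ₃))) := algebraMap _ _
  have hj₃ : Function.Injective j₃ := IsFractionRing.injective _ _
  let j₂ := j₃.comp g₂
  have hj₂ : Function.Injective j₂ := hj₃.comp hginj₂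
  let j₁ := j₂.comp g₁
  have hj₁ : Function.Injective j₁ := hj₂.comp hginj₁
  let j₀ := j₁.comp g₀
  have hj₀ : Function.Injective j₀ := hj₁.comp hginj₀
  haveI hl₃ := isLocalRing_range j₃
  haveI hl₂ := isLocalRing_range j₂
  haveI hl₁ := isLocalRing_range j₁
  haveI hl₀ := isLocalRing_range j₀
  -- ### the root read in `L′` is the same at every level
  have hr₁ : j₁ (algebraMap (AdjoinRoot P₁) _ (AdjoinRoot.root P₁)) = j₀ (algebraMap (AdjoinRoot P) _ (AdjoinRoot.root P)) := by
    change _ = j₁ (g₀ (algebraMap (AdjoinRoot P) _ (AdjoinRoot.root P)))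
    rw [map_root_of_comp_eq (Subring.inclusion d₀₁.1) P g₀ hg₀]
  have hr₂ : j₂ (algebraMap (AdjoinRoot P₂) _ (AdjoinRoot.root P₂)) = j₀ (algebraMap (AdjoinRoot P) _ (AdjoinRoot.root P)) := by
    rw [← hr₁]
    change _ = j₂ (g₁ (algebraMap (AdjoinRoot P₁) _ (AdjoinRoot.root P₁)))
    rw [map_root_of_comp_eq (Subring.inclusion d₁₂.1) P₁ g₁ hg₁]
  have hr₃ : j₃ (algebraMap (AdjoinRoot P₃) _ (AdjoinRoot.root P₃)) = j₀ (algebraMap (AdjoinRoot P) _ (AdjoinRoot.root P)) := by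
    rw [← hr₂]
    change _ = j₃ (g₂ (algebraMap (AdjoinRoot P₂) _ (AdjoinRoot.root P₂)))
    rw [map_root_of_comp_eq (Subring.inclusion d₂₃.1) P₂ g₂ hg₂]
  -- ### the four level packages
  have hL₃ := levelLift_range P₃ φ₃ θ hθ₃ hP₃m hsep₃ j₃ hj₃
  have hL₂ := levelLift_range P₂ φ₂ θ hθ₂ hP₂m hsep₂ j₂ hj₂
  have hL₁ := levelLift_range P₁ φ₁ θ hθ₁ hP₁m hsep₁ j₁ hj₁
  have hL₀ := levelLift_range P φ₀ θ hθ₀ hPmon hsep₀ j₀ hj₀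
  rw [hr₃] at hL₃
  rw [hr₂] at hL₂
  rw [hr₁] at hL₁
  -- ### residual rationality of the two lower steps
  have hcoeff₁ : ∀ c : S₁, ∃ a₀ : AdjoinRoot P,
      AdjoinRoot.of P₁ c - ι₀ a₀ ∈ RingHom.ker (AdjoinRoot.lift (φ₁.comp (residue S₁)) θ hθ₁) := by
    intro c
    obtain ⟨q, hq⟩ := hprim (ResidueField.map (Subring.inclusion d₁₂.1) (residue S₁ c))
    refine ⟨AdjoinRoot.mk P q, ?_⟩
    rw [RingHom.mem_ker, map_sub, sub_eq_zero, AdjoinRoot.lift_of, lift_liftMap_mk d₀₁ P φ₁ θ hθ₁ q]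
    have h2 := congrArg φ₂ hq
    rw [Polynomial.hom_eval₂] at h2
    have hfun : (φ₁.comp (ResidueField.map (Subring.inclusion d₀₁.1))).comp (residue S₀) =
        φ₂.comp ((ResidueField.map (Subring.inclusion (d₀₁.trans d₁₂).1)).comp (residue S₀)) := by
      ext s
      simp only [RingHom.comp_apply, hφ₁, hφ₂, hφ₃, RingHom.id_apply, ResidueField.map_residue]
      rfl
    rw [hfun]
    exact h2
  have hcoeff₂ : ∀ c : S₂, ∃ a₁ : AdjoinRoot P₁,
      AdjoinRoot.of P₂ c - ι₁ a₁ ∈ RingHom.ker (AdjoinRoot.lift (φ₂.comp (residue S₂)) θ hθ₂) := by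
    intro c
    obtain ⟨q, hq⟩ := hprim (residue S₂ c)
    refine ⟨AdjoinRoot.mk P₁ (q.map (Subring.inclusion d₀₁.1)), ?_⟩
    rw [RingHom.mem_ker, map_sub, sub_eq_zero, AdjoinRoot.lift_of, lift_liftMap_mk d₁₂ P₁ φ₂ θ hθ₂, Polynomial.eval₂_map]
    have h2 := congrArg φ₂ hq
    rw [Polynomial.hom_eval₂] at h2
    have hfun : ((φ₂.comp (ResidueField.map (Subring.inclusion d₁₂.1))).comp (residue S₁)).comp (Subring.inclusion d₀₁.1) =
        φ₂.comp ((ResidueField.map (Subring.inclusion (d₀₁.trans d₁₂).1)).comp (residue S₀)) := by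
      ext s
      simp only [RingHom.comp_apply, hφ₂, hφ₃, RingHom.id_apply, ResidueField.map_residue]
      rfl
    rw [hfun]
    exact h2
  have hroot₁ : ∃ a₀ : AdjoinRoot P, AdjoinRoot.root P₁ - ι₀ a₀ ∈ RingHom.ker (AdjoinRoot.lift (φ₁.comp (residue S₁)) θ hθ₁) :=
    ⟨AdjoinRoot.root P, by rw [AdjoinRoot.lift_root, sub_self]; exact Ideal.zero_mem _⟩
  have hroot₂ : ∃ a₁ : AdjoinRoot P₁, AdjoinRoot.root P₂ - ι₁ a₁ ∈ RingHom.ker (AdjoinRoot.lift (φ₂.comp (residue S₂)) θ hθ₂) :=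
    ⟨AdjoinRoot.root P₁, by rw [AdjoinRoot.lift_root, sub_self]; exact Ideal.zero_mem _⟩
  have hrat₁ : ∀ t : Localization.AtPrime (RingHom.ker (AdjoinRoot.lift (φ₁.comp (residue S₁)) θ hθ₁)),
      ∃ t₀ : Localization.AtPrime (RingHom.ker (AdjoinRoot.lift (φ₀.comp (residue S₀)) θ hθ₀)), t - g₀ t₀ ∈ maximalIdeal _ := by
    intro t
    obtain ⟨a₀, ha₀⟩ := exists_sub_mem_maximalIdeal_of_coeff P₁ ι₀ _ hcoeff₁ hroot₁ t
    refine ⟨algebraMap (AdjoinRoot P) _ a₀, ?_⟩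
    have hga : g₀ (algebraMap (AdjoinRoot P) _ a₀) = algebraMap (AdjoinRoot P₁) _ (ι₀ a₀) := RingHom.congr_fun hg₀ a₀
    rw [hga]
    exact ha₀
  have hrat₂ : ∀ t : Localization.AtPrime (RingHom.ker (AdjoinRoot.lift (φ₂.comp (residue S₂)) θ hθ₂)),
      ∃ t₁ : Localization.AtPrime (RingHom.ker (AdjoinRoot.lift (φ₁.comp (residue S₁)) θ hθ₁)), t - g₁ t₁ ∈ maximalIdeal _ := by
    intro t
    obtain ⟨a₁, ha₁⟩ := exists_sub_mem_maximalIdeal_of_coeff P₂ ι₁ _ hcoeff₂ hroot₂ t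
    refine ⟨algebraMap (AdjoinRoot P₁) _ a₁, ?_⟩
    have hga : g₁ (algebraMap (AdjoinRoot P₁) _ a₁) = algebraMap (AdjoinRoot P₂) _ (ι₁ a₁) := RingHom.congr_fun hg₁ a₁
    rw [hga]
    exact ha₁
  have hRR₁ := isResiduallyRational_range g₀ j₁ hj₁ hrat₁ (range_comp_le g₀ j₁)
  have hRR₂ := isResiduallyRational_range g₁ j₂ hj₂ hrat₂ (range_comp_le g₁ j₂)
  -- ### assembly
  refine ⟨_, inferInstance, j₀.range, j₁.range, j₂.range, j₃.range, hl₀, hl₁, hl₂, hl₃,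
    j₀ (algebraMap (AdjoinRoot P) _ (AdjoinRoot.root P)), P,
    j₀.rangeRestrict.comp (algebraMap S₀ _), j₁.rangeRestrict.comp (algebraMap S₁ _),
    j₂.rangeRestrict.comp (algebraMap S₂ _), j₃.rangeRestrict.comp (algebraMap S₃ _),
    range_comp_le g₀ j₁, range_comp_le g₁ j₂, range_comp_le g₂ j₃,
    hPmon, eval₂_rangeLift_root P φ₀ θ hθ₀ hPmon j₀, hL₀, hL₁, hL₂, hL₃, ?_, ?_, ?_,
    subringDominates_range_comp g₀ j₁ hj₁, subringDominates_range_comp g₁ j₂ hj₂, subringDominates_range_comp g₂ j₃ hj₃,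
    hRR₁, hRR₂⟩
  · intro s
    change j₁ (algebraMap S₁ _ (Subring.inclusion d₀₁.1 s)) = j₁ (g₀ (algebraMap S₀ _ s))
    rw [map_algebraMap_of_comp_eq (Subring.inclusion d₀₁.1) P g₀ hg₀ s]
  · intro s
    change j₂ (algebraMap S₂ _ (Subring.inclusion d₁₂.1 s)) = j₂ (g₁ (algebraMap S₁ _ s))
    rw [map_algebraMap_of_comp_eq (Subring.inclusion d₁₂.1) P₁ g₁ hg₁ s]
  · intro s
    change j₃ (algebraMap S₃ _ (Subring.inclusion d₂₃.1 s)) = j₃ (g₂ (algebraMap S₂ _ s))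
    rw [map_algebraMap_of_comp_eq (Subring.inclusion d₂₃.1) P₂ g₂ hg₂ s]

end Summit.ResolutionOfSingularities.ResolutionOfSingularities.Theorems.SwitchingDichotomy.EtaleLift

end
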